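import Summits.Ventures.CertifiedQuantumChemistry.Certificates.HubbardRingL6LiftFeasible
import Summits.Ventures.CertifiedQuantumChemistry.Rows.HubbardRingL6StrongCouplingLimit
import HarnessLib

/-!
# Ventures/CertifiedQuantumChemistry — Certificates/HubbardRingL6LiftPlateauFloor.lean: the KERNEL-GRADE PLATEAU FLOOR of
# the half-filled Hubbard 6-ring — `OPT_DQG(hubbardRingTV 6 1 U; 3, 3) ≤ v*/U` for every rational `U ≥ 2⁵¹`
# (`v* = −2497596381347381036465714781/112589990684262400000000000 ≈ −22.18311`), hence for every `c < c⋆ := −(5+√13)/2 − v*/4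
# ≈ 1.2430024`, eventually in `U`, `c ≤ (U/4)·(E₀ − OPT_DQG)`: `liminf_U ĉ_DQG(6; U) ≥ 1.2430023`, per site `≥ 0.207167`

HONEST FRAMING (verbatim): certified bounds for a stated model Hamiltonian in a stated basis; not a
claim about the real molecule beyond that model.

Seat rdm-B (gen 43; last file of the L = 6 lift assembly, plan `tools/x14-g42/l6/MEMO-L6-KERNEL-FLOOR.md` §8; the `L = 6` twin
of gen 42's `…L4LiftPlateauFloor.lean`). INPUTS: `…L6LiftFeasible.lean` (the exact lift family is `(3,3)`-sector-DQG-feasible for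
`0 < ε ≤ 2⁻⁵¹`), gen 39's ring energy formula `RingEnergy.hubbardRingTV_re_rdmEnergy_eq` (`Re E = −2t·Σ bonds + U·Σ doublons`),
the objective sums of the coefficients `LiftL6.l6_objective_sums` (`…L6LiftCoeffRows` §4: `B₁`, `D₂`), the Literature bound
`pqgSectorEnergy_le_rdmEnergy`, and — on the `E₀` side — the typer's `tendsto_mul_energy_hubbardRingTV_six`
(`U·E₀(hubbardRingTV 6 1 U; 3, 3) → −2(5 + √13)`, `Rows/HubbardRingL6StrongCouplingLimit.lean`).

THE THEOREMS: **`lift6_re_rdmEnergy`** — at `ε = 1/U` the family member's energy on `hubbardRingTV 6 1 U` is EXACTLY `v*/U`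
(`U·Re E = −2B₁ + D₂ = v*`; no `1/U²` remainder); **`lift6_pqgSectorEnergy_le`** — `OPT_DQG(hubbardRingTV 6 1 U; 3, 3) ≤ v*/U`
for every rational `U ≥ 2⁵¹`; **`eventually_mul_pqgSectorEnergy_le_vstar`** — `U·OPT_DQG ≤ v*` eventually (indeed from
`U = 2⁵¹` on); **`eventually_le_scaled_gap6`** — for every `c < c⋆`, `∀ᶠ U in atTop (ℚ), c ≤ (U/4)·(Model.energy _ 3 3 −
Model.pqgSectorEnergy _ 3 3)`; **`l6cFloor_gt`** / **`l6cFloor_lt`** — `1.2430023 < c⋆ < 1.2430024` (so, per site,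
`c⋆/6 > 0.207167`); **`l6cFloor_le_of_tendsto`** — IF the scaled gap converges (as S-U, `Rows/ConjectureSU.lean`, asserts with
`c_DQG(6) ∈ [1.18, 1.25]`), its limit is `≥ c⋆`; **`l6cFloor_le_of_conjectureSU_clause`** — the same read on S-U's own convergence
clause (`L = 2n`, `n = 3`): any candidate plateau function has `c 3 ≥ c⋆ > 1.2430023`, so S-U's bracket `[1.18, 1.25]` can only be
met in `[c⋆, 1.25]`; **`eventually_dqg_not_exact6`** — eventual NON-exactness of the level-DQG relaxation on the 6-ring.

READING. The LOWER half, at kernel grade, of the `L = 6` entry of STRUCTURE §2.2.14 (until now words + exact-certificate grade,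
`liminf_U ĉ_DQG(6;U) ≥ 1.2430023798`): at strong coupling the level-DQG relaxation of the half-filled Hubbard 6-ring misses AT
LEAST `c⋆·J ≈ 1.243·J` of the ground-state energy (`J = 4t²/U`), i.e. `≥ 0.2072·J` PER SITE — a non-vanishing fraction
(`c⋆/6 / ((5+√13)/12) ≈ 28.9 %`) of the superexchange energy `|E₀| ≈ (5+√13)/2 · J/… ` per ring. Nothing is claimed about an UPPER
bound on the scaled gap, the existence of the limit, or `L ≥ 8`; no clause of S-U is proved or refuted (`[1.18, 1.25]` meets
`[c⋆, ∞)`). NOT a row of `CERTIFIED.md`, no claim node; S-U UNTOUCHED. 0 sorry; two small `def`s (`l6vstar`, `l6cFloor`); standard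
axioms. References (docstring-only): D. A. Mazziotti, Adv. Chem. Phys. 134 (2007) ch. 3 §II.B, §II.F; M. Nakata et al., J. Chem.
Phys. 128 (2008) 164113 §II.C.
-/

set_option linter.style.longLine false

namespace Summit.Ventures.CertifiedQuantumChemistry

namespace LiftL6

open Matrix Finset DQGGap Filter Topology
open Literature.MathematicalPhysics.QuantumLattice Literature.MathematicalPhysics.QuantumChemistry
open Summit.Ventures.CertifiedQuantumChemistry.Hamiltonians
open scoped ComplexOrder

/-! ## §1 The constants, the energy along the family and the bound on `OPT_DQG` -/

/-- **`v*`**: the exact value of `U·Re E` along the L = 6 lift family at `ε = 1/U` (`= −2B₁ + D₂ ≈ −22.18311207`). -/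
def l6vstar : ℚ := -2497596381347381036465714781 / 112589990684262400000000000

/-- **`c⋆ = −(5 + √13)/2 − v*/4 ≈ 1.2430023798`**: the kernel-grade floor of the 6-ring's scaled DQG gap at strong coupling
(`−(5+√13)/2 = lim U·E₀/4`, the typer's T-K0-6). -/
noncomputable def l6cFloor : ℝ := -(5 + Real.sqrt 13) / 2 - (l6vstar : ℝ) / 4

/-- `v* = −2B₁ + D₂` (the objective sums of `…L6LiftCoeffRows` §4). -/
theorem l6vstar_eq : (l6vstar : ℝ) =
    -2 * (((249759638135076303618624261 : ℚ) / 11258999068426240000000000 : ℚ) : ℝ) +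
      (((2497596381354145035906770439 : ℚ) / 112589990684262400000000000 : ℚ) : ℝ) := by
  rw [l6vstar]; push_cast; norm_num

/-- Bond sum of the one-matrix family: `Σ_{p,σ} γ(pσ; (p+1)σ) = ε·B₁`. -/
theorem liftGamR6_bond (ε : ℝ) :
    ∑ p : Fin 6, ∑ σ : Fin 2, liftGamR6 ε (orb p σ) (orb (finRotate 6 p) σ) =
      ε * (((249759638135076303618624261 : ℚ) / 11258999068426240000000000 : ℚ) : ℝ) := by
  simp only [liftGamR6_orb]
  simp only [sum_family6]
  simp only [l6_objective_sums.1]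
  simp [Fin.sum_univ_three]

/-- Doublon sum of the two-matrix family: `Σ_p Γ(p↑ p↓; p↑ p↓) = ε²·D₂`. -/
theorem liftGGR6_doublon (ε : ℝ) :
    ∑ p : Fin 6, liftGGR6 ε (orb p 0, orb p 1) (orb p 0, orb p 1) =
      ε ^ 2 * (((2497596381354145035906770439 : ℚ) / 112589990684262400000000000 : ℚ) : ℝ) := by
  simp only [liftGGR6_orb]
  simp only [sum_family6]
  simp only [l6_objective_sums.2]
  simp [Fin.sum_univ_three]

/-- **THE ENERGY OF THE FAMILY** for `hubbardRingTV 6 1 U` at `ε = 1/U` (`U ≠ 0`): `Re E = v*/U` EXACTLY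
(gen 39's ring energy formula `Re E = −2t·Σ bonds + U·Σ doublons`; only Hermiticity and antisymmetry are used). -/
theorem lift6_re_rdmEnergy (U : ℚ) (hU : U ≠ 0) :
    (rdmEnergy (fun p q => ((hubbardRingTV 6 1 U).h p q : ℂ)) (fun p q r s => ((hubbardRingTV 6 1 U).eri p q r s : ℂ))
        ((hubbardRingTV 6 1 U).ecore : ℂ) (liftGamC6 (1 / U)) (liftGGC6 (1 / U))).re = (l6vstar : ℝ) / U := by
  have hγ : ∀ x y, liftGamC6 (1 / U) x y = ((liftGamR6 (1 / U) x y : ℝ) : ℂ) := fun _ _ => rfl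
  have hΓ : ∀ P R, liftGGC6 (1 / U) P R = ((liftGGR6 (1 / U) P R : ℝ) : ℂ) := fun _ _ => rfl
  rw [RingEnergy.hubbardRingTV_re_rdmEnergy_eq (by norm_num) 1 U (liftGamC6_isHermitian _) (liftGGC6_swap_fst _)
    (liftGGC6_swap_snd _)]
  simp only [hγ, hΓ, Complex.ofReal_re, liftGamR6_bond, liftGGR6_doublon, l6vstar_eq]
  have hU' : (U : ℝ) ≠ 0 := by exact_mod_cast hU
  push_cast
  field_simp

/-- **`OPT_DQG ≤ v*/U` FOR EVERY RATIONAL `U ≥ 2⁵¹`**: the programme's value on `hubbardRingTV 6 1 U`, sector `(3,3)`, lies below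
the energy of the feasible family member at `ε = 1/U`. -/
theorem lift6_pqgSectorEnergy_le {U : ℚ} (hU : (2 : ℚ) ^ 51 ≤ U) :
    Model.pqgSectorEnergy (hubbardRingTV 6 1 U) 3 3 ≤ (l6vstar : ℝ) / U := by
  have hU0 : (0 : ℚ) < U := lt_of_lt_of_le (by positivity) hU
  have hUq : U ≠ 0 := hU0.ne'
  have hε0 : (0 : ℝ) < 1 / U := by
    have : (0 : ℝ) < U := by exact_mod_cast hU0
    positivity
  have hε1 : (1 : ℝ) / U ≤ 1 / 2 ^ 51 := by
    have h : ((2 : ℚ) ^ 51 : ℝ) ≤ (U : ℝ) := by exact_mod_cast hU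
    push_cast at h
    exact one_div_le_one_div_of_le (by positivity) h
  have hf := lift6_isDQGFeasibleSector hε0 hε1
  have h := pqgSectorEnergy_le_rdmEnergy (fun p q => ((hubbardRingTV 6 1 U).h p q : ℂ))
    (fun p q r s => ((hubbardRingTV 6 1 U).eri p q r s : ℂ)) ((hubbardRingTV 6 1 U).ecore : ℂ) hf
  rw [lift6_re_rdmEnergy U hUq] at h
  exact h

/-! ## §2 The kernel-grade plateau floor: `liminf_U (U/4)·(E₀ − OPT_DQG) ≥ c⋆` on the 6-ring -/

/-- **`U·OPT_DQG ≤ v*` EVENTUALLY** (indeed for every rational `U ≥ 2⁵¹`). -/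
theorem eventually_mul_pqgSectorEnergy_le_vstar :
    ∀ᶠ U : ℚ in atTop, (U : ℝ) * Model.pqgSectorEnergy (hubbardRingTV 6 1 U) 3 3 ≤ (l6vstar : ℝ) := by
  filter_upwards [eventually_ge_atTop ((2 : ℚ) ^ 51)] with U hU
  have hU0 : (0 : ℝ) < U := by exact_mod_cast lt_of_lt_of_le (by positivity) hU
  have h := lift6_pqgSectorEnergy_le hU
  rwa [le_div_iff₀ hU0, mul_comm] at h

/-- **THE PLATEAU FLOOR.** For every `c < c⋆ = −(5+√13)/2 − v*/4`, eventually (as `U → ∞` along `ℚ`)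
`c ≤ (U/4)·(E₀(6; 1, U; 3, 3) − OPT_DQG(6; 1, U; 3, 3))`: S-U's 6-ring plateau constant is AT LEAST `c⋆ ≈ 1.2430024` at kernel
grade (the `E₀` side is the typer's `U·E₀ → −2(5+√13)`, `Rows/HubbardRingL6StrongCouplingLimit.lean`). -/
theorem eventually_le_scaled_gap6 {c : ℝ} (hc : c < l6cFloor) :
    ∀ᶠ U : ℚ in atTop, c ≤ (U : ℝ) / 4 *
      (Model.energy (hubbardRingTV 6 1 U) 3 3 - Model.pqgSectorEnergy (hubbardRingTV 6 1 U) 3 3) := by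
  have hδ : 0 < l6cFloor - c := by linarith
  have hE : ∀ᶠ U : ℚ in atTop, -(2 * (5 + Real.sqrt 13)) - 4 * (l6cFloor - c) < (U : ℝ) * (hubbardRingTV 6 1 U).energy 3 3 :=
    tendsto_mul_energy_hubbardRingTV_six.eventually (lt_mem_nhds (by linarith))
  filter_upwards [hE, eventually_mul_pqgSectorEnergy_le_vstar] with U h1 h2
  have : (U : ℝ) / 4 * (Model.energy (hubbardRingTV 6 1 U) 3 3 - Model.pqgSectorEnergy (hubbardRingTV 6 1 U) 3 3) =
      ((U : ℝ) * (hubbardRingTV 6 1 U).energy 3 3 - (U : ℝ) * Model.pqgSectorEnergy (hubbardRingTV 6 1 U) 3 3) / 4 := by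
    ring
  rw [this]
  have hc' : l6cFloor = -(5 + Real.sqrt 13) / 2 - (l6vstar : ℝ) / 4 := rfl
  rw [hc'] at hδ h1
  linarith

/-- **`c⋆ > 1.2430023`** (from `√13 < 3.60555128`). Per site: `c⋆/6 > 0.207167`. -/
theorem l6cFloor_gt : (1.2430023 : ℝ) < l6cFloor := by
  have h13 : Real.sqrt 13 < 3.60555128 := by
    rw [show (3.60555128 : ℝ) = Real.sqrt (3.60555128 ^ 2) by rw [Real.sqrt_sq (by norm_num)]]
    exact Real.sqrt_lt_sqrt (by norm_num) (by norm_num)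
  rw [l6cFloor, l6vstar]
  push_cast
  nlinarith

/-- **`c⋆ < 1.2430024`** (from `√13 > 3.60555127`). -/
theorem l6cFloor_lt : l6cFloor < (1.2430024 : ℝ) := by
  have h13 : (3.60555127 : ℝ) < Real.sqrt 13 := by
    rw [show (3.60555127 : ℝ) = Real.sqrt (3.60555127 ^ 2) by rw [Real.sqrt_sq (by norm_num)]]
    exact Real.sqrt_lt_sqrt (by norm_num) (by norm_num)
  rw [l6cFloor, l6vstar]
  push_cast
  nlinarith

/-- **COROLLARY (the limit, if it exists, is at least `c⋆`).** If the scaled gap of the 6-ring converges along `ℚ`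
(as S-U conjectures, `Rows/ConjectureSU.lean`), its limit is `≥ c⋆ > 1.2430023`. -/
theorem l6cFloor_le_of_tendsto {c₀ : ℝ} (h : Tendsto (fun U : ℚ => (U : ℝ) / 4 *
      (Model.energy (hubbardRingTV 6 1 U) 3 3 - Model.pqgSectorEnergy (hubbardRingTV 6 1 U) 3 3)) atTop (𝓝 c₀)) :
    l6cFloor ≤ c₀ :=
  le_of_forall_lt_imp_le_of_dense fun _ hc => ge_of_tendsto h (eventually_le_scaled_gap6 hc)

/-- **COROLLARY (S-U's shape).** For ANY candidate plateau function `c : ℕ → ℝ` satisfying the convergence clause of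
conjecture S-U, level DQG (`Rows/ConjectureSU.lean`, `ConjectureSU_DQG`: for every `n ≥ 2` the scaled gap of the ring
`L = 2n` tends to `c n`), the 6-ring constant obeys `c⋆ ≤ c 3` — so S-U's registered bracket `c 3 ∈ [1.18, 1.25]` can only be
met in `[c⋆, 1.25] ⊂ (1.2430023, 1.25]`. (S-U itself is neither proved nor refuted here.) -/
theorem l6cFloor_le_of_conjectureSU_clause {c : ℕ → ℝ}
    (h : ∀ n, 2 ≤ n → 0 ≤ c n ∧
      Tendsto (fun U : ℚ => ((U : ℝ) / 4) *
          (Model.energy (hubbardRingTV (2*n) 1 U) n n - Model.pqgSectorEnergy (hubbardRingTV (2*n) 1 U) n n))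
        atTop (𝓝 (c n))) :
    l6cFloor ≤ c 3 :=
  l6cFloor_le_of_tendsto (h 3 (by norm_num)).2

/-- **COROLLARY (eventual non-exactness).** The level-DQG relaxation is NOT exact on the half-filled Hubbard 6-ring at every
sufficiently large `U` (along `ℚ`): `∀ᶠ U, OPT_DQG(hubbardRingTV 6 1 U; 3, 3) < E₀(hubbardRingTV 6 1 U; 3, 3)` — the plateau
floor with `c = 1 < c⋆`. -/
theorem eventually_dqg_not_exact6 :
    ∀ᶠ U : ℚ in atTop, Model.pqgSectorEnergy (hubbardRingTV 6 1 U) 3 3 < Model.energy (hubbardRingTV 6 1 U) 3 3 := by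
  have hc : (1 : ℝ) < l6cFloor := lt_trans (by norm_num) l6cFloor_gt
  filter_upwards [eventually_le_scaled_gap6 hc, eventually_gt_atTop (0 : ℚ)] with U h1 h2
  have hU : (0 : ℝ) < U := by exact_mod_cast h2
  have h3 : 0 < (U : ℝ) / 4 *
      (Model.energy (hubbardRingTV 6 1 U) 3 3 - Model.pqgSectorEnergy (hubbardRingTV 6 1 U) 3 3) :=
    lt_of_lt_of_le (by norm_num) h1
  rcases mul_pos_iff.mp h3 with ⟨_, h⟩ | ⟨h, _⟩
  · linarith
  · linarith

end LiftL6

end Summit.Ventures.CertifiedQuantumChemistry
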